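import Literature.AnabelianGeometry.AbsoluteAnabelian.AbsTopIII.KummerSeparationLaws
import HarnessLib

/-!
# [AbsTopIII] §1: the `CurveModel` interface with the PLACE law for decomposition groups and the fibre /
# cusp-lifting laws of base-change legs (successor structure, layer VI; statements only)

Mochizuki, *Topics in Absolute Anabelian Geometry III*, §1, Thm. 1.9 (d)(e) pp. 37–38, Prop. 1.8 (i) p. 36
(lit key `paper:url-5493eb38cbb7`).

Sixth layer of the abc-iut cell's "ONE SOURCE OF LAWS" tower (`… ⊆ CoherentKummerModel ⊆
SeparatedKummerModel` ⊆ `PlacedKummerModel`, THIS FILE; abc-iut-w5-d213 under abc-iut-L4-lead RULING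
#5j (3)).  Three further relations of the intended étale-`π₁` model needed by the (e)-BRIDGE of Thm. 1.9
(the places dictionary of a SATURATED tagged system, `IntrinsicKummerModel.IsSaturated` v3 /
`Thm19eSat`), found when the bridge was planned line by line:

* (P-sat) `nfPlace_eq_of_decomp_le` — PLACES VERSUS DECOMPOSITION GROUPS: the geometric points of `Z`
  over a closed NF-point `y` correspond to the double cosets `Δ_Z g D_y` (decomposition groups of the
  pro-points over `y` are the conjugates `g D_y g⁻¹`; those over one point of `Z(k̄)` form a `Δ_Z`-orbit);
  two rational NF-points of levels — `x₁ ∈ Z₁ = Z ×_k k₁` and `x₂ ∈ U₂ ⊆ Z₂ = Z ×_k k₂` — whose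
  decomposition groups map into conjugates `(δ₁ g) D_y (δ₁ g)⁻¹`, `(δ₂ g) D_y (δ₂ g)⁻¹` with
  `δ₁, δ₂ ∈ Δ_Z` lie over the SAME geometric point, hence NAME THE SAME PLACE of `K_{Z_NF}/k̄_NF`
  (layer III's `nfPlace`).  This is what turns the group-theoretic saturation of a system into
  surjectivity of its point dictionary onto the places ("`V_X ⥲ X(k)`", Prop. 1.3 (b)).  Stated for a
  scheme-like `Z` of genus `≥ 2` over a Kummer-faithful field (where distinct geometric points have
  distinct decomposition groups, cf. layer I's (S)).
* (B×O-fibre) `exists_pt_bc_open` — for the open `U′ = U ×_Z Z′ ⊆ Z′` over `U ⊆ Z` (layer II's (B×O)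
  square), every point of `Z′` over a point of `U` is a point of `U′` (`U′` is the full preimage).
* (B-cusp-lift) `exists_cusp_above_bc` — along `Z′ = Z ×_k k′ → Z` every cusp of `Z` has a cusp of `Z′`
  ABOVE it (decomposition containment; converse companion of layer II's `exists_cusp_bc`).

All three are TRUE relations of the intended model; no new Prop FACT; interface data.  HONEST FRAMING:
statements-first; typed ≠ proved; nothing here bears on [IUTchIII] Cor. 3.12.
-/

noncomputable section

open CategoryTheory
open scoped Pointwise

namespace Literature.AnabelianGeometry.AbsoluteAnabelian.AbsTopIII

universe u

/-- **The curve interface with the place law and the fibre / cusp-lifting laws** (layer VI over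
`SeparatedKummerModel`): (P-sat) rational NF-points of levels whose decomposition groups map into
`Δ_Z`-equivalent conjugates of `D_y` name the same place of `K_{Z_NF}`; (B×O-fibre) `U ×_Z Z′` is the full
preimage of `U`; (B-cusp-lift) cusps lift along base-change legs.  Interface data (relations of the
intended model), no Prop-valued named fact. [cite: MochizukiAbsTopIII2015, Thm 1.9 (e) p.38] -/
structure PlacedKummerModel : Type (u + 2) extends SeparatedKummerModel.{u} where
  /-- (P-sat, Thm. 1.9 (e) / Prop. 1.3 (b) "`V_X ⥲ X(k)`": places = geometric points = double cosets
  `Δ_Z g D_y`) for a scheme-like `Z` of genus `≥ 2` over a Kummer-faithful field: a rational NF-point `x₁`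
  of a base change `Z₁` and a rational NF-point `x₂` of a cofinite open `U₂` of a base change `Z₂` whose
  decomposition groups map into `(δ₁ g) D_y (δ₁ g)⁻¹`, resp. `(δ₂ g) D_y (δ₂ g)⁻¹`, with `δ₁, δ₂ ∈ Δ_Z`,
  NAME THE SAME PLACE of `K_{Z_NF}/k̄_NF`. -/
  nfPlace_eq_of_decomp_le : ∀ {Z₁ U₂ Z₂ Z : Curve} (h₁ : IsBaseChangeOf Z₁ Z) (u₂ : IsCofiniteOpen U₂ Z₂)
    (h₂ : IsBaseChangeOf Z₂ Z), IsScheme Z → 2 ≤ genus Z → IsKummerFaithful (base Z) →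
    ∀ (x₁ : Point Z₁) (hx₁ : IsNFPoint Z₁ x₁) (hr₁ : IsRationalPt Z₁ x₁) (x₂ : Point U₂)
      (hx₂ : IsNFPoint Z₂ (ptRes u₂ x₂)) (hr₂ : IsRationalPt Z₂ (ptRes u₂ x₂)) (y : Point Z)
      (g δ₁ δ₂ : (ext Z).arith), δ₁ ∈ (ext Z).geom → δ₂ ∈ (ext Z).geom →
      (decomp Z₁ x₁).map (bc h₁).arith.toMonoidHom ≤ MulAut.conj (δ₁ * g) • decomp Z y →
      (decomp U₂ x₂).map (res u₂ ≫ bc h₂).arith.toMonoidHom ≤ MulAut.conj (δ₂ * g) • decomp Z y →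
      nfPlace h₁ x₁ hx₁ hr₁ = nfPlace h₂ (ptRes u₂ x₂) hx₂ hr₂
  /-- (B×O-fibre) for `U′ = U ×_Z Z′ ⊆ Z′` over `U ⊆ Z`: a point of `Z′` over a point of `U` is a point of
  `U′` (over that point). -/
  exists_pt_bc_open : ∀ {U U' Z Z' : Curve} (hU : IsBaseChangeOf U' U) (hZ : IsBaseChangeOf Z' Z)
    (h : IsCofiniteOpen U Z) (h' : IsCofiniteOpen U' Z') (x : Point U) (p : Point Z'),
    bcPt hZ p = ptRes h x → ∃ w : Point U', ptRes h' w = p ∧ bcPt hU w = x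
  /-- (B-cusp-lift) along `Z′ = Z ×_k k′ → Z` every cusp of `Z` has a cusp of `Z′` above it. -/
  exists_cusp_above_bc : ∀ {Z' Z : Curve} (h : IsBaseChangeOf Z' Z) (c : (cusps Z).Cusp),
    ∃ (c' : (cusps Z').Cusp) (g : (ext Z).arith),
      ((cusps Z').Dcusp c').map (bc h).arith.toMonoidHom ≤ MulAut.conj g • (cusps Z).Dcusp c

end Literature.AnabelianGeometry.AbsoluteAnabelian.AbsTopIII
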